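import Summits.ValiantsHypothesis.ValiantsHypothesis.Theorems.LangWeilTransferTameResolutionFactorWeightPrelims

/-!
# LangWeilTransfer, support `TameResolution` (stmt-6378) / crux `TameTransfer` (stmt-6373) —
# an elementary FACTOR WEIGHT BOUND for integer polynomials in several variables

Route `LangWeilTransfer` of `ValiantsHypothesis`. The quantitative half of `TameResolution` needs
the log-weight of an irreducible FACTOR `Q` of an explicitly bounded eliminant to stay inside the
single-exponential envelope. Gelfond's inequality / Mignotte's bound (Mahler measure) would do;
here we prove a weaker but sufficient and completely elementary bound by Lagrange interpolation
in every variable: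

* `weight_le_of_dvd` — if `G ∣ F ≠ 0` in `ℤ[X_0, …, X_{n-1}]` and every partial degree of `F` is
  `≤ D`, then `wt G ≤ wt F · ((D+1)(2D+1)^{2D})ⁿ`
  (`wt` = `Literature.Computability.AlgebraicComplexity.weight`, the `ℓ¹` norm of the
  coefficients);
* `log_weight_le_of_dvd` — hence
  `log₂ wt G ≤ log₂ wt F + n (2D+2)(log₂(2D+2) + 1)`, single-exponential when `D` is.

Proof (induction on `n`; no analysis). `n = 0`: `G ∣ F` in `ℤ`, so `|G| ≤ |F|`. Step: write
`F, G ∈ R[X_0]`, `R = ℤ[X_1..X_n]` (`finSuccEquiv`). Among the `2D+1` integers `a ∈ {0, …, 2D}`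
at most `D` kill `F(a, ·)`, so there is a set `A` of `deg_{X_0} G + 1 ≤ D + 1` nodes with
`F(a, ·) ≠ 0`; for them `G(a,·) ∣ F(a,·)` and, inductively,
`wt G(a,·) ≤ wt F(a,·) Bⁿ ≤ (2D+1)^D wt F · Bⁿ`. Lagrange interpolation with integer nodes,
cleared of denominators (`Δ_a = ∏_{b ≠ a} (a - b)`, `N_a = ∏_{b≠a} (X_0 - b)`):
`(∏_a Δ_a) G = Σ_a G(a,·) (∏_{a'≠a} Δ_{a'}) N_a` in `R[X_0]` (both sides have `X_0`-degree
`≤ |A| - 1` and agree at the `|A|` nodes), whence `wt G ≤ |A| (2D+1)^D max_a wt G(a,·)`.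

Honest framing: a helper `--supports` an open crux of a conditional route; VP ≠ VNP is NOT proved
and nothing here bears on it.
-/

noncomputable section

open MvPolynomial Polynomial
open scoped BigOperators

-- the summit and the problem share the name `ValiantsHypothesis` (D-0017 single-conjunct layout)
set_option linter.dupNamespace false

namespace Summit.ValiantsHypothesis.ValiantsHypothesis.Theorems.LangWeilTransfer

open Literature.Computability.AlgebraicComplexity

/-! ## The factor weight bound -/

section Main

/-- **Elementary factor weight bound.** If `G ∣ F` in `ℤ[X_0, …, X_{n-1}]`, `F ≠ 0`, and every
partial degree of `F` is at most `D`, then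
`wt G ≤ wt F · ((D + 1) · (2D + 1)^(2D))ⁿ`. -/
theorem weight_le_of_dvd : ∀ (n : ℕ) {D : ℕ} (F G : MvPolynomial (Fin n) ℤ), F ≠ 0 → G ∣ F →
    (∀ i, degreeOf i F ≤ D) →
    weight G ≤ weight F * ((D + 1) * (2 * D + 1) ^ (2 * D)) ^ n := by
  intro n
  induction n with
  | zero =>
    intro D F G hF hGF _
    -- constants: `G ∣ F` in `ℤ`
    rw [pow_zero, mul_one]
    obtain ⟨H, rfl⟩ := hGF
    have hG : G = MvPolynomial.C (G.coeff 0) := MvPolynomial.eq_C_of_isEmpty G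
    have hH : H = MvPolynomial.C (H.coeff 0) := MvPolynomial.eq_C_of_isEmpty H
    rw [hG, hH, ← map_mul, weight_C, weight_C]
    refine Int.natAbs_le_of_dvd_ne_zero (dvd_mul_right _ _) fun h0 => hF ?_
    rw [hG, hH, ← map_mul, h0, map_zero]
  | succ n ih =>
    intro D F G hF hGF hdeg
    classical
    -- the two polynomials in `R[X_0]`, `R = ℤ[X_1..X_n]`, as opaque variables
    obtain ⟨P, hP⟩ : ∃ P, finSuccEquiv ℤ n F = P := ⟨_, rfl⟩
    obtain ⟨Qp, hQp⟩ : ∃ Qp, finSuccEquiv ℤ n G = Qp := ⟨_, rfl⟩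
    have hGQ : G = (finSuccEquiv ℤ n).symm Qp := by rw [← hQp, AlgEquiv.symm_apply_apply]
    have hP0 : P ≠ 0 := fun h => hF ((finSuccEquiv ℤ n).injective (by rw [hP, h, map_zero]))
    have hG0 : G ≠ 0 := by
      rintro rfl
      obtain ⟨H, hH⟩ := hGF
      exact hF (by rw [hH, zero_mul])
    -- degrees in `X_0`
    have hPdeg : P.natDegree ≤ D := by rw [← hP, natDegree_finSuccEquiv]; exact hdeg 0
    have hQdeg : Qp.natDegree ≤ D := by
      rw [← hQp, natDegree_finSuccEquiv]
      obtain ⟨H, hH⟩ := hGF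
      have hH0 : H ≠ 0 := fun h => hF (by rw [hH, h, mul_zero])
      have := hdeg 0
      rw [hH, degreeOf_mul_eq hG0 hH0] at this
      omega
    -- the nodes
    obtain ⟨A, hAcard, hAbnd, hAgood⟩ := exists_good_nodes P hP0 hPdeg hQdeg
    -- the values at the nodes
    have hQpdvd : Qp ∣ P := by
      obtain ⟨H, hH⟩ := hGF
      exact ⟨finSuccEquiv ℤ n H, by rw [← hP, ← hQp, hH, map_mul]⟩
    set B : ℕ := (D + 1) * (2 * D + 1) ^ (2 * D) with hB
    have hnode : ∀ a ∈ A, weight (Qp.eval (MvPolynomial.C a)) ≤ (2 * D + 1) ^ D * weight F * B ^ n := by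
      intro a ha
      have hFa0 : P.eval (MvPolynomial.C a) ≠ 0 := hAgood a ha
      have hdvd : Qp.eval (MvPolynomial.C a) ∣ P.eval (MvPolynomial.C a) := Polynomial.eval_dvd hQpdvd
      have hdegFa : ∀ j, degreeOf j (P.eval (MvPolynomial.C a)) ≤ D := fun j => by
        rw [← hP]; exact (degreeOf_eval_C_le F a j).trans (hdeg j.succ)
      refine (ih _ _ hFa0 hdvd hdegFa).trans (Nat.mul_le_mul_right _ ?_)
      have hab : a.natAbs ≤ 2 * D + 1 := by
        obtain ⟨h0, h1⟩ := hAbnd a ha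
        zify; rw [abs_of_nonneg h0]; omega
      rw [← hP]
      exact weight_eval_C_le F a (by omega) hab (by rw [hP]; exact hPdeg)
    -- the interpolation identity in `R[X_0]`
    obtain ⟨Δ, hΔ⟩ : ∃ Δ : ℤ, (∏ a ∈ A, ∏ b ∈ A.erase a, (a - b)) = Δ := ⟨_, rfl⟩
    have hΔa : ∀ a, (∏ b ∈ A.erase a, (a - b)) ≠ 0 := fun a =>
      Finset.prod_ne_zero_iff.mpr fun b hb => sub_ne_zero.mpr (Finset.ne_of_mem_erase hb).symm
    have hΔ0 : Δ ≠ 0 := by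
      rw [← hΔ]
      exact Finset.prod_ne_zero_iff.mpr fun a _ => hΔa a
    have hid := lagrange_identity A Qp (by rw [hAcard]; omega)
    rw [hΔ] at hid
    -- read it back in `ℤ[X_0..X_n]`: `wt (C Δ · G) = |Δ| wt G`
    have hWG : weight ((finSuccEquiv ℤ n).symm (Polynomial.C (MvPolynomial.C Δ) * Qp)) =
        Δ.natAbs * weight G := by
      rw [map_mul, finSuccEquiv_symm_C, rename_C, ← hGQ, weight_C_mul]
    -- and bound the right-hand side
    have hterm : ∀ a ∈ A, weight ((finSuccEquiv ℤ n).symm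
        (Polynomial.C (Qp.eval (MvPolynomial.C a)) *
          (Polynomial.C (MvPolynomial.C (∏ a' ∈ A.erase a, ∏ b ∈ A.erase a', (a' - b))) *
            ∏ b ∈ A.erase a, (Polynomial.X - Polynomial.C (MvPolynomial.C b))))) ≤
        ((2 * D + 1) ^ D * weight F * B ^ n) * (Δ.natAbs * (2 * D + 1) ^ D) := by
      intro a ha
      refine (weight_finSuccEquiv_symm_C_mul_le _ _).trans (Nat.mul_le_mul (hnode a ha) ?_)
      refine (weight_finSuccEquiv_symm_C_mul_le _ _).trans ?_
      rw [weight_C]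
      refine Nat.mul_le_mul ?_ ?_
      · -- `|Δ / Δ_a| ≤ |Δ|`
        rw [← hΔ, ← Finset.prod_erase_mul _ _ ha, Int.natAbs_mul]
        exact Nat.le_mul_of_pos_right _ (Int.natAbs_pos.mpr (hΔa a))
      · -- `wt N_a ≤ (2D+1)^D`
        rw [map_prod]
        refine (weight_finset_prod_le _ _).trans ?_
        calc ∏ b ∈ A.erase a, weight ((finSuccEquiv ℤ n).symm
              (Polynomial.X - Polynomial.C (MvPolynomial.C b)))
            ≤ ∏ _b ∈ A.erase a, (2 * D + 1) :=
              Finset.prod_le_prod' fun b hb => (weight_finSuccEquiv_symm_X_sub_C_le b).trans (by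
                obtain ⟨h0, h1⟩ := hAbnd b (Finset.mem_of_mem_erase hb)
                zify; rw [abs_of_nonneg h0]; omega)
          _ = (2 * D + 1) ^ (A.card - 1) := by
              rw [Finset.prod_const, Finset.card_erase_of_mem ha]
          _ ≤ (2 * D + 1) ^ D := Nat.pow_le_pow_right (by omega) (by rw [hAcard]; omega)
    have hRHS : Δ.natAbs * weight G ≤
        A.card * (((2 * D + 1) ^ D * weight F * B ^ n) * (Δ.natAbs * (2 * D + 1) ^ D)) := by
      rw [← hWG, hid, map_sum]
      refine (weight_finset_sum_le _ _).trans ?_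
      calc ∑ a ∈ A, weight ((finSuccEquiv ℤ n).symm
            (Polynomial.C (Qp.eval (MvPolynomial.C a)) *
              (Polynomial.C (MvPolynomial.C (∏ a' ∈ A.erase a, ∏ b ∈ A.erase a', (a' - b))) *
                ∏ b ∈ A.erase a, (Polynomial.X - Polynomial.C (MvPolynomial.C b)))))
          ≤ ∑ _a ∈ A, ((2 * D + 1) ^ D * weight F * B ^ n) * (Δ.natAbs * (2 * D + 1) ^ D) :=
            Finset.sum_le_sum hterm
        _ = _ := by rw [Finset.sum_const, smul_eq_mul]
    -- combine: divide by `|Δ| > 0`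
    have hΔpos : 0 < Δ.natAbs := Int.natAbs_pos.mpr hΔ0
    have key : Δ.natAbs * weight G ≤ Δ.natAbs * (weight F * B ^ (n + 1)) := by
      refine hRHS.trans ?_
      rw [hAcard]
      have h1 : Qp.natDegree + 1 ≤ D + 1 := by omega
      calc (Qp.natDegree + 1) * ((2 * D + 1) ^ D * weight F * B ^ n * (Δ.natAbs * (2 * D + 1) ^ D))
          ≤ (D + 1) * ((2 * D + 1) ^ D * weight F * B ^ n * (Δ.natAbs * (2 * D + 1) ^ D)) :=
            Nat.mul_le_mul_right _ h1
        _ = Δ.natAbs * (weight F * (B ^ n * ((D + 1) * ((2 * D + 1) ^ D * (2 * D + 1) ^ D)))) := by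
            ring
        _ = Δ.natAbs * (weight F * B ^ (n + 1)) := by
            rw [← pow_add, ← two_mul, hB, pow_succ]
    exact Nat.le_of_mul_le_mul_left key hΔpos

/-- The same bound with the partial-degree hypothesis replaced by a `totalDegree` bound. -/
theorem weight_le_of_dvd_of_totalDegree_le {n D : ℕ} (F G : MvPolynomial (Fin n) ℤ) (hF : F ≠ 0)
    (hGF : G ∣ F) (hD : F.totalDegree ≤ D) :
    weight G ≤ weight F * ((D + 1) * (2 * D + 1) ^ (2 * D)) ^ n :=
  weight_le_of_dvd n F G hF hGF fun i => (degreeOf_le_totalDegree F i).trans hD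

/-- **Logarithmic form**: `log₂ wt G ≤ log₂ wt F + n (2D + 2)(log₂(2D + 2) + 1)`. -/
theorem log_weight_le_of_dvd {n D : ℕ} (F G : MvPolynomial (Fin n) ℤ) (hF : F ≠ 0) (hGF : G ∣ F)
    (hdeg : ∀ i, degreeOf i F ≤ D) :
    Nat.log 2 (weight G) ≤
      Nat.log 2 (weight F) + n * ((2 * D + 2) * (Nat.log 2 (2 * D + 2) + 1)) := by
  have h := weight_le_of_dvd n F G hF hGF hdeg
  set K : ℕ := (2 * D + 2) * (Nat.log 2 (2 * D + 2) + 1) with hK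
  -- `(D+1)(2D+1)^(2D) ≤ (2D+2)^(2D+1) ≤ 2^K`
  have hB : (D + 1) * (2 * D + 1) ^ (2 * D) ≤ 2 ^ K := by
    have h2 : 2 * D + 2 ≤ 2 ^ (Nat.log 2 (2 * D + 2) + 1) :=
      (Nat.lt_pow_succ_log_self (by norm_num) _).le
    calc (D + 1) * (2 * D + 1) ^ (2 * D) ≤ (2 * D + 2) * (2 * D + 2) ^ (2 * D) :=
          Nat.mul_le_mul (by omega) (Nat.pow_le_pow_left (by omega) _)
      _ = (2 * D + 2) ^ (2 * D + 1) := by ring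
      _ ≤ (2 ^ (Nat.log 2 (2 * D + 2) + 1)) ^ (2 * D + 1) := Nat.pow_le_pow_left h2 _
      _ = 2 ^ ((Nat.log 2 (2 * D + 2) + 1) * (2 * D + 1)) := (pow_mul _ _ _).symm
      _ ≤ 2 ^ K := Nat.pow_le_pow_right (by norm_num) (by rw [hK]; nlinarith)
  have hBn : ((D + 1) * (2 * D + 1) ^ (2 * D)) ^ n ≤ 2 ^ (K * n) :=
    calc ((D + 1) * (2 * D + 1) ^ (2 * D)) ^ n ≤ (2 ^ K) ^ n := Nat.pow_le_pow_left hB n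
      _ = 2 ^ (K * n) := (pow_mul 2 K n).symm
  have hw : weight F ≠ 0 := fun h0 => hF ((weight_eq_zero_iff F).mp h0)
  -- `log₂ (w · 2^L) = log₂ w + L` for `w ≠ 0`
  have hlog : ∀ L : ℕ, Nat.log 2 (weight F * 2 ^ L) = Nat.log 2 (weight F) + L := by
    intro L
    induction L with
    | zero => simp
    | succ L ih =>
      rw [pow_succ, ← mul_assoc, Nat.log_mul_base (by norm_num) (by positivity), ih, add_assoc]
  calc Nat.log 2 (weight G)
      ≤ Nat.log 2 (weight F * 2 ^ (K * n)) := Nat.log_mono_right (h.trans (Nat.mul_le_mul_left _ hBn))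
    _ = Nat.log 2 (weight F) + K * n := hlog _
    _ = Nat.log 2 (weight F) + n * K := by rw [mul_comm]

end Main

end Summit.ValiantsHypothesis.ValiantsHypothesis.Theorems.LangWeilTransfer

end
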